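import Mathlib
import Literature.NumberTheory.Transcendental.BakerLogarithmsConclusion
import HarnessLib

/-!
# Baker's theorem over the exponential field — the logarithmic layer

Trunk `Literature/NumberTheory/Transcendental`, family `periods`. A repackaging of Baker's theorem
(`Literature.NumberTheory.Transcendental.bakerFin_holds`, Baker 1975, Theorem 2.1, vendored proof) in
the coordinates used by "Baker over the exponential field" statements: for `ℚ`-linearly independent
`z : Fin n → ℂ` put `K = ℚ(e^{z₁},…,e^{zₙ})`, `b = trdeg_ℚ K`, `L = algebraicClosure K ℂ` (the algebraic
closure of `K` INSIDE `ℂ`) and `d = dim_L span_L {1, z₁, …, zₙ}`. When every `e^{zᵢ}` is algebraic,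
`K ⊆ ℚ̄`, `L = ℚ̄` (`algebraicClosure.eq_restrictScalars_of_isAlgebraic`) and Baker's theorem says
exactly `d = n + 1`, whence `n + 1 ≤ d + b`.

* `baker_expField_logLayer` — `∀ n z, LinearIndependent ℚ z → (∀ i, IsAlgebraic ℚ (e^{zᵢ})) →
  n + 1 ≤ finrank_L (span_L (insert 1 (range z))) + trdeg_ℚ K` (PROVED from `bakerFin_holds`).

Design: the scalar field is `algebraicClosure K ℂ : IntermediateField K ℂ` acting on `ℂ` by the
subfield action; the transport of linear independence from `ℚ̄` to `L` is coefficientwise (same subset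
of `ℂ`). Nothing here is new mathematics; what is NOT here: any statement with a transcendental `e^{zᵢ}`
(`b ≥ 1`), which is open (Gelfond–Schneider/`e ⊥ π`-type content).

## References
* [Baker1975] A. Baker, *Transcendental Number Theory*, Cambridge Univ. Press, 1975, Ch. 2, Theorem 2.1, p. 17
  (doi:10.1017/cbo9780511565977).
-/

noncomputable section

open Complex

namespace Literature.NumberTheory.Transcendental

/-- **Baker's theorem over the exponential field, logarithmic layer** (Baker 1975, Theorem 2.1,
transported): if `z₁,…,zₙ` are `ℚ`-linearly independent and every `e^{zᵢ}` is algebraic, then with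
`K = ℚ(e^{z₁},…,e^{zₙ})` and `L = algebraicClosure K ℂ` one has
`n + 1 ≤ dim_L span_L {1, z₁,…,zₙ} + trdeg_ℚ K` (indeed `L = ℚ̄`, the span has dimension `n + 1` by
Baker, and `trdeg_ℚ K = 0`). [cite: Baker1975, Theorem 2.1] -/
theorem baker_expField_logLayer (n : ℕ) (z : Fin n → ℂ) (hz : LinearIndependent ℚ z)
    (halg : ∀ i, IsAlgebraic ℚ (cexp (z i))) :
    ((n + 1 : ℕ) : Cardinal) ≤
      (Module.finrank
          (algebraicClosure (IntermediateField.adjoin ℚ (Set.range (cexp ∘ z))) ℂ)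
          (Submodule.span
            (algebraicClosure (IntermediateField.adjoin ℚ (Set.range (cexp ∘ z))) ℂ)
            (insert (1 : ℂ) (Set.range z))) : Cardinal) +
        Algebra.trdeg ℚ (IntermediateField.adjoin ℚ (Set.range (cexp ∘ z))) := by
  classical
  set K : IntermediateField ℚ ℂ := IntermediateField.adjoin ℚ (Set.range (cexp ∘ z))
    with hK
  haveI hKalg : Algebra.IsAlgebraic ℚ K :=
    (IntermediateField.isAlgebraic_adjoin_iff_isAlgebraic ℚ ℂ).2 (by
      rintro _ ⟨i, rfl⟩
      exact halg i)
  -- `L = algebraicClosure K ℂ` has the same carrier as `ℚ̄ = algebraicClosure ℚ ℂ`.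
  have hL : ((algebraicClosure ℚ ℂ : IntermediateField ℚ ℂ) : Set ℂ) =
      ((algebraicClosure K ℂ : IntermediateField K ℂ) : Set ℂ) := by
    rw [algebraicClosure.eq_restrictScalars_of_isAlgebraic ℚ K ℂ]
    rfl
  -- Baker's theorem over `ℚ̄`.
  have hB : LinearIndependent (algebraicClosure ℚ ℂ) (fun o : Option (Fin n) => o.elim 1 z) :=
    bakerFin_holds n z halg hz
  -- Transport the scalars from `ℚ̄` to `L` (same subset of `ℂ`, same action).
  have hBL : LinearIndependent (algebraicClosure K ℂ) (fun o : Option (Fin n) => o.elim 1 z) := by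
    rw [Fintype.linearIndependent_iff] at hB ⊢
    intro g hg o
    have hmem : ∀ o', ((g o' : ℂ)) ∈ (algebraicClosure ℚ ℂ : IntermediateField ℚ ℂ) := fun o' => by
      rw [← SetLike.mem_coe, hL]
      exact (g o').2
    have h0 := hB (fun o' => ⟨(g o' : ℂ), hmem o'⟩) (by
      simpa only [IntermediateField.smul_def] using hg) o
    have h0' : ((g o : ℂ)) = 0 := by
      simpa using congrArg (fun c : (algebraicClosure ℚ ℂ : IntermediateField ℚ ℂ) => (c : ℂ)) h0
    exact_mod_cast h0'
  -- The family `none ↦ 1, some i ↦ zᵢ` has range `insert 1 (range z)`.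
  have hrange : Set.range (fun o : Option (Fin n) => o.elim 1 z) = insert (1 : ℂ) (Set.range z) := by
    ext x
    simp only [Set.mem_range, Set.mem_insert_iff, Option.exists, Option.elim]
    constructor
    · rintro (h | ⟨i, h⟩)
      · exact Or.inl h.symm
      · exact Or.inr ⟨i, h⟩
    · rintro (h | ⟨i, h⟩)
      · exact Or.inl h.symm
      · exact Or.inr ⟨i, h⟩
  have hfin : Module.finrank (algebraicClosure K ℂ)
      (Submodule.span (algebraicClosure K ℂ) (insert (1 : ℂ) (Set.range z))) = n + 1 := by
    rw [← hrange, finrank_span_eq_card hBL, Fintype.card_option, Fintype.card_fin]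
  rw [hfin]
  exact le_self_add

end Literature.NumberTheory.Transcendental
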